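import Summits.ResolutionOfSingularities.ResolutionOfSingularities.Theorems.MarkedTransferCampaignW46MohWindowSurfaceHeavyDichotomy
import HarnessLib

/-!
# [OURS · L1 W4.6 rung (iii-2), EVERY `p`] Surface Moh window — COUNTING AGAINST HEAVY STEPS: the length of a permissible sequence inside
# the coefficient surface-window regime is at most `Φ(E₀) + C(p) · #{heavy-centred steps}` (cell res-hironaka, LADDER-RESOLUTION rung L,
# D-0089; seat res-L1-s46-pv-5 gen 5; host MarkedTransfer, `--supports stmt-ResolutionOfSingularities-16155 --as helper`; statement file
# `…CampaignW46MohWindowSurface.lean`)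

HONEST FRAMING. Nothing here is a statement of H. Hironaka's manuscript [Hironaka2017] and nothing here asserts that any
statement of it holds. THEOREM about the OURS regime `CampaignW46.Regime.mohWindowSurface` (o1 §5; every `p`, every `K`): the
quantitative form of the heavy-centre dichotomy (`…HeavyDichotomy.lean`). With the potential `Φ(E) = Σ_{ξ ∈ Sing(E)} (4p − 1)^{residualOrder(J_ξ)}`
of `…TameExitBound.lean`: a TAME-centred step lowers `Φ` by `≥ 1`; a HEAVY-centred step raises it by at most
`C(p) − 1`, `C(p) = 2(2p − 1) · (4p − 1)^(2p − 1)` (at most `2(2p − 1)` singular children, `…ChildCount.lean`, each of residual order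
`≤ 2p − 1`). Hence `len ≤ Φ(E₀) + C(p) · #{k < len : the centre of step k is not tame}`. AI-written; AI review is weaker than expert
review. No `sorry`; axioms standard.

WHAT IS PROVED.
* `sum_pow_val_succ_le_add_of_bound` — abstract potential step WITHOUT a drop hypothesis: `Σ' + 1 ≤ Σ + N (N+1)^M` when the `≤ N` points
  over the centre have weight `≤ M`.
* `potential_succ_add_one_le_add_of_mohWindowSurface` — the in-regime step bound `Φ(E′) + 1 ≤ Φ(E) + C(p)`.
* `FinPermissibleRun.len_le_potential_add_mul_card_heavy` — **`len ≤ Φ(E₀) + C(p) · #H`** for every finite set `H` of indices containing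
  the heavy-centred steps. [ZariskiSamuel1960] [Matsumura1987] [HauserWagner2014]
-/

noncomputable section

set_option linter.dupNamespace false -- mandated namespace of this single-conjunct summit

open CategoryTheory AlgebraicGeometry TopologicalSpace IsLocalRing

namespace Summit.ResolutionOfSingularities.ResolutionOfSingularities.Theorems

namespace CampaignW46

open Literature.AlgebraicGeometry.Resolution
open Literature.AlgebraicGeometry.Hironaka2017.S02Preliminaries
open Literature.AlgebraicGeometry.Hironaka2017.Datum
open Scheme.IdealSheafData

universe u

section Campaign

variable {p : ℕ} [Fact p.Prime] {K : Type u} [Field K] [CharP K p]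
variable {A A' : AmbientDatum p K} {E : IdealExponent A.Z}

/-! ## 1. The abstract potential step without a drop hypothesis -/

/-- **Abstract potential step, bounded growth.** For a permissible blow-up with `Sing(E)` a finite set of closed points and `Sing(E′)`
finite, weights transported off the centre, at most `N` singular points over the centre each of weight `≤ M`:
`Σ_{Sing(E′)} (N+1)^{val′} + 1 ≤ Σ_{Sing(E)} (N+1)^{val} + N · (N+1)^M`. [folklore] -/
theorem sum_pow_val_succ_le_add_of_bound {D : Closeds A.Z} (π : A'.Z ⟶ A.Z)
    (hπ : IsBlowup π (vanishingIdeal D)) (hD : E.IsPermissibleCentre A.hom D) (hfin : E.sing.Finite)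
    (hcl : E.sing ⊆ Literature.AlgebraicGeometry.Hironaka2017.S02Preliminaries.closedPoints A.Z)
    (hfin' : (E.transform π D).sing.Finite) (val : A.Z → ℕ) (val' : A'.Z → ℕ)
    (hoff : ∀ x' ∈ (E.transform π D).sing, π.base x' ∉ (D : Set A.Z) → val' x' = val (π.base x')) (N M : ℕ)
    (hM : ∀ x' ∈ (E.transform π D).sing, π.base x' ∈ (D : Set A.Z) → val' x' ≤ M)
    (hN : ((E.transform π D).sing ∩ π.base ⁻¹' (D : Set A.Z)).Finite ∧
      ((E.transform π D).sing ∩ π.base ⁻¹' (D : Set A.Z)).ncard ≤ N) :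
    (∑ x' ∈ hfin'.toFinset, (N + 1) ^ val' x') + 1 ≤ (∑ x ∈ hfin.toFinset, (N + 1) ^ val x) + N * (N + 1) ^ M := by
  classical
  obtain ⟨ξ, hξS, hξcl, hDξ⟩ := IsPermissibleCentre.exists_eq_singleton_of_isolatedSing hD ⟨hfin, hcl⟩
  set S : Finset A.Z := hfin.toFinset with hS
  set S' : Finset A'.Z := hfin'.toFinset with hS'
  set Son : Finset A'.Z := S'.filter fun x' => π.base x' = ξ with hSon
  set Soff : Finset A'.Z := S'.filter fun x' => ¬ π.base x' = ξ with hSoff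
  have hξmem : ξ ∈ S := by rw [hS, Set.Finite.mem_toFinset]; exact hξS
  have hmemS' : ∀ x', x' ∈ S' ↔ x' ∈ (E.transform π D).sing := fun x' => by rw [hS', Set.Finite.mem_toFinset]
  have hsplit : ∑ x' ∈ S', (N + 1) ^ val' x' = ∑ x' ∈ Soff, (N + 1) ^ val' x' + ∑ x' ∈ Son, (N + 1) ^ val' x' := by
    rw [hSoff, hSon, ← Finset.sum_filter_add_sum_filter_not S' (fun x' => π.base x' = ξ) (fun x' => (N + 1) ^ val' x'), add_comm]
  have hoffD : ∀ x' ∈ Soff, π.base x' ∉ (D : Set A.Z) := fun x' hx' => by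
    rw [hSoff, Finset.mem_filter] at hx'
    rw [hDξ]; exact hx'.2
  have hinj : Set.InjOn π.base (Soff : Set A'.Z) :=
    (MohWindow.injOn_preimage_compl hπ).mono fun x' hx' => hoffD x' hx'
  have himage : Soff.image π.base ⊆ S.erase ξ := by
    intro η hη
    obtain ⟨x', hx', rfl⟩ := Finset.mem_image.mp hη
    have hx'S : x' ∈ (E.transform π D).sing := (hmemS' x').mp (Finset.mem_filter.mp hx').1
    refine Finset.mem_erase.mpr ⟨?_, ?_⟩
    · have := hoffD x' hx'; rw [hDξ] at this; exact this
    · rw [hS, Set.Finite.mem_toFinset]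
      exact MohWindowSurfacePermissible.base_mem_sing_of_not_over_centre π hπ hx'S (hoffD x' hx')
  have hXle : ∑ x' ∈ Soff, (N + 1) ^ val' x' ≤ ∑ x ∈ S.erase ξ, (N + 1) ^ val x :=
    calc ∑ x' ∈ Soff, (N + 1) ^ val' x' = ∑ x' ∈ Soff, (N + 1) ^ val (π.base x') :=
          Finset.sum_congr rfl fun x' hx' => by rw [hoff x' ((hmemS' x').mp (Finset.mem_filter.mp hx').1) (hoffD x' hx')]
      _ = ∑ x ∈ Soff.image π.base, (N + 1) ^ val x :=
          (Finset.sum_image (f := fun x => (N + 1) ^ val x) fun a ha b hb h => hinj ha hb h).symm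
      _ ≤ ∑ x ∈ S.erase ξ, (N + 1) ^ val x := Finset.sum_le_sum_of_subset_of_nonneg himage fun _ _ _ => Nat.zero_le _
  have hSval : ∑ x ∈ S.erase ξ, (N + 1) ^ val x + (N + 1) ^ val ξ = ∑ x ∈ S, (N + 1) ^ val x :=
    Finset.sum_erase_add S (fun x => (N + 1) ^ val x) hξmem
  -- over the centre: at most `N` points, each of weight `≤ M`
  have hmem : ∀ x' ∈ Son, x' ∈ (E.transform π D).sing ∩ π.base ⁻¹' (D : Set A.Z) := fun x' hx' => by
    have h1 := Finset.mem_filter.mp hx'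
    exact ⟨(hmemS' x').mp h1.1, by rw [Set.mem_preimage, hDξ, h1.2]; exact Set.mem_singleton ξ⟩
  have hcard : Son.card ≤ N := by
    have hsub : Son ⊆ hN.1.toFinset := fun x' hx' => (Set.Finite.mem_toFinset _).mpr (hmem x' hx')
    calc Son.card ≤ hN.1.toFinset.card := Finset.card_le_card hsub
      _ = ((E.transform π D).sing ∩ π.base ⁻¹' (D : Set A.Z)).ncard := (Set.ncard_eq_toFinset_card _ hN.1).symm
      _ ≤ N := hN.2
  have hon' : ∑ x' ∈ Son, (N + 1) ^ val' x' ≤ N * (N + 1) ^ M := by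
    have hle : ∀ x' ∈ Son, (N + 1) ^ val' x' ≤ (N + 1) ^ M := fun x' hx' =>
      Nat.pow_le_pow_right (Nat.succ_pos N) (hM x' (hmem x' hx').1 (hmem x' hx').2)
    have := Finset.sum_le_card_nsmul Son (fun x' => (N + 1) ^ val' x') _ hle
    rw [smul_eq_mul] at this
    exact this.trans (Nat.mul_le_mul_right _ hcard)
  have hξ1 : 1 ≤ (N + 1) ^ val ξ := Nat.one_le_pow _ _ (Nat.succ_pos N)
  rw [hsplit, ← hSval]
  omega

/-! ## 2. The in-regime step: bounded growth of the potential -/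

/-- **The potential grows by at most `C(p) − 1` at an in-regime step** (any centre): with `N = 2(2p − 1)` and `Φ(E) = Σ_{Sing} (N+1)^{residualOrder}`,
`Φ(E′) + 1 ≤ Φ(E) + N (N+1)^(2p − 1)`. [folklore] -/
theorem potential_succ_add_one_le_add_of_mohWindowSurface {D : Closeds A.Z} (π : A'.Z ⟶ A.Z) (hπ : IsBlowup π (vanishingIdeal D))
    (hD : E.IsPermissibleCentre A.hom D) (hRg : Regime.mohWindowSurface A E)
    (hRg' : Regime.mohWindowSurface A' (E.transform π D)) :
    (∑ x' ∈ hRg'.2.1.toFinset, (2 * (2 * p - 1) + 1) ^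
        (residualOrder (E.transform π D).b (A'.Z.presheaf.stalk x') (stalkIdeal (E.transform π D).J x')).toNat) + 1 ≤
      (∑ x ∈ hRg.2.1.toFinset, (2 * (2 * p - 1) + 1) ^ (residualOrder E.b (A.Z.presheaf.stalk x) (stalkIdeal E.J x)).toNat) +
        2 * (2 * p - 1) * (2 * (2 * p - 1) + 1) ^ (2 * p - 1) :=
  sum_pow_val_succ_le_add_of_bound π hπ hD hRg.2.1 hRg.2.2.1 hRg'.2.1 _ _
    (fun _ _ hover => congrArg ENat.toNat
      (MohWindowSurfacePermissible.residualOrder_eq_of_not_over_centre (E := E) π hπ hover))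
    (2 * (2 * p - 1)) (2 * p - 1) (fun _ hx' _ => residualOrder_toNat_le_of_mohWindowSurface hRg' hx')
    (ncard_sing_inter_preimage_centre_le π hπ hD hRg)

/-! ## 3. The count against heavy steps -/

/-- **[OURS · L1 W4.6 rung (iii-2), every `p`] THE LENGTH OF AN IN-REGIME SEQUENCE IS BOUNDED BY THE INITIAL POTENTIAL PLUS `C(p)` TIMES
THE NUMBER OF HEAVY-CENTRED STEPS.** For a finite §2.1-permissible sequence inside `Regime.mohWindowSurface` and any finite set `H` of
indices containing every `k < len` whose centre has a NON-TAME point: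
`len ≤ Φ(E₀) + C(p) · #H`, `Φ(E₀) = Σ_{ξ ∈ Sing(E₀)} (4p − 1)^{residualOrder(J_ξ)}`, `C(p) = 2(2p − 1) · (4p − 1)^(2p − 1)`. NOT a statement
of the manuscript. [folklore] -/
theorem FinPermissibleRun.len_le_potential_add_mul_card_heavy (r : FinPermissibleRun p K)
    (hr : ∀ k, k ≤ r.len → Regime.mohWindowSurface (r.A k) (r.E k)) (H : Finset ℕ)
    (hH : ∀ k, k < r.len → (∃ ξ ∈ (r.D k : Set (r.A k).Z),
      ¬ MohWindowSurfaceTameAt (r.E k).b ((r.A k).Z.presheaf.stalk ξ) (stalkIdeal (r.E k).J ξ)) → k ∈ H) :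
    r.len ≤ (∑ x ∈ (hr 0 (Nat.zero_le _)).2.1.toFinset,
      (2 * (2 * p - 1) + 1) ^ (residualOrder (r.E 0).b ((r.A 0).Z.presheaf.stalk x) (stalkIdeal (r.E 0).J x)).toNat) +
      2 * (2 * p - 1) * (2 * (2 * p - 1) + 1) ^ (2 * p - 1) * H.card := by
  classical
  let Φ : (k : ℕ) → k ≤ r.len → ℕ := fun k hk => ∑ x ∈ (hr k hk).2.1.toFinset,
    (2 * (2 * p - 1) + 1) ^ (residualOrder (r.E k).b ((r.A k).Z.presheaf.stalk x) (stalkIdeal (r.E k).J x)).toNat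
  let C : ℕ := 2 * (2 * p - 1) * (2 * (2 * p - 1) + 1) ^ (2 * p - 1)
  -- the two one-step bounds, stated for an arbitrary next stage `E₁ = transform`
  have key : ∀ k (hk : Regime.mohWindowSurface (r.A k) (r.E k)) (E₁ : IdealExponent (r.A (k + 1)).Z)
      (h₁ : Regime.mohWindowSurface (r.A (k + 1)) E₁) (heq : E₁ = (r.E k).transform (r.π k) (r.D k))
      (hperm : (r.E k).IsPermissibleCentre (r.A k).hom (r.D k)) (hbl : IsBlowup (r.π k) (vanishingIdeal (r.D k))),
      ((∑ x ∈ h₁.2.1.toFinset, (2 * (2 * p - 1) + 1) ^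
          (residualOrder E₁.b ((r.A (k + 1)).Z.presheaf.stalk x) (stalkIdeal E₁.J x)).toNat) + 1 ≤
        (∑ x ∈ hk.2.1.toFinset, (2 * (2 * p - 1) + 1) ^
          (residualOrder (r.E k).b ((r.A k).Z.presheaf.stalk x) (stalkIdeal (r.E k).J x)).toNat) + C) ∧
      ((∀ ξ ∈ (r.D k : Set (r.A k).Z), MohWindowSurfaceTameAt (r.E k).b ((r.A k).Z.presheaf.stalk ξ) (stalkIdeal (r.E k).J ξ)) →
        (∑ x ∈ h₁.2.1.toFinset, (2 * (2 * p - 1) + 1) ^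
          (residualOrder E₁.b ((r.A (k + 1)).Z.presheaf.stalk x) (stalkIdeal E₁.J x)).toNat) + 1 ≤
        ∑ x ∈ hk.2.1.toFinset, (2 * (2 * p - 1) + 1) ^
          (residualOrder (r.E k).b ((r.A k).Z.presheaf.stalk x) (stalkIdeal (r.E k).J x)).toNat) := by
    intro k hk E₁ h₁ heq hperm hbl
    subst heq
    exact ⟨potential_succ_add_one_le_add_of_mohWindowSurface (r.π k) hbl hperm hk h₁,
      fun htame => potential_succ_add_one_le_of_tame_centre (r.π k) hbl hperm hk h₁ htame⟩
  -- telescoping with the heavy counter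
  have htel : ∀ k (hk : k ≤ r.len), Φ k hk + k ≤ Φ 0 (Nat.zero_le _) + C * (H.filter fun m => m < k).card := by
    intro k
    induction k with
    | zero => intro hk; simp
    | succ k ih =>
      intro hk1
      have hk : k ≤ r.len := Nat.le_of_succ_le hk1
      have hklt : k < r.len := hk1
      obtain ⟨hgrow, htame⟩ := key k (hr k hk) (r.E (k + 1)) (hr (k + 1) hk1) (r.E_succ k hklt) (r.permissible k hklt)
        (r.blowup k hklt)
      have ih' := ih hk
      have hsub : (H.filter fun m => m < k) ⊆ H.filter fun m => m < k + 1 := by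
        intro m hm
        rw [Finset.mem_filter] at hm ⊢
        exact ⟨hm.1, Nat.lt_succ_of_lt hm.2⟩
      have hmono : (H.filter fun m => m < k).card ≤ (H.filter fun m => m < k + 1).card := Finset.card_le_card hsub
      by_cases hheavy : ∃ ξ ∈ (r.D k : Set (r.A k).Z),
          ¬ MohWindowSurfaceTameAt (r.E k).b ((r.A k).Z.presheaf.stalk ξ) (stalkIdeal (r.E k).J ξ)
      · -- heavy step: the counter increases by one
        have hkH : k ∈ H := hH k hklt hheavy
        have hcard : (H.filter fun m => m < k).card + 1 ≤ (H.filter fun m => m < k + 1).card := by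
          have hins : insert k (H.filter fun m => m < k) ⊆ H.filter fun m => m < k + 1 := by
            intro m hm
            rcases Finset.mem_insert.mp hm with rfl | hm
            · exact Finset.mem_filter.mpr ⟨hkH, Nat.lt_succ_self _⟩
            · exact hsub hm
          have hnot : k ∉ H.filter fun m => m < k := fun h => by
            have := (Finset.mem_filter.mp h).2; omega
          calc (H.filter fun m => m < k).card + 1 = (insert k (H.filter fun m => m < k)).card :=
                (Finset.card_insert_of_notMem hnot).symm
            _ ≤ (H.filter fun m => m < k + 1).card := Finset.card_le_card hins
        have hg : Φ (k + 1) hk1 + 1 ≤ Φ k hk + C := hgrow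
        nlinarith
      · -- tame step
        push Not at hheavy
        have ht : Φ (k + 1) hk1 + 1 ≤ Φ k hk := htame hheavy
        nlinarith
  have hfin := htel r.len le_rfl
  have hHle : (H.filter fun m => m < r.len).card ≤ H.card := Finset.card_le_card (Finset.filter_subset _ _)
  have : Φ 0 (Nat.zero_le _) + C * (H.filter fun m => m < r.len).card ≤ Φ 0 (Nat.zero_le _) + C * H.card :=
    Nat.add_le_add_left (Nat.mul_le_mul_left _ hHle) _
  show r.len ≤ Φ 0 (Nat.zero_le _) + C * H.card
  omega

end Campaign

end CampaignW46

end Summit.ResolutionOfSingularities.ResolutionOfSingularities.Theorems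

end
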